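/-
Copyright (c) 2026 the pub-hodgecm-mathlib formalisation cell (harness21).  Prover seat hodgecm-mathlib-F0P3-p03 (g15): road «S3-ram» (LEAD F0P3a-plan (g12); owner
F0P3a-p06 (g15)); F0P3a-p01 (g16)'s junction plan J-PACK (2026-09-01T23:57:42Z), item J2 «ALTERNATION IN ANY MODEL»; 2026-09-02.
-/
import Literature.NumberTheory.Automorphic.UnitaryLatticeTreeFormTransport       -- ★ p847249 (F0P3a-p01 (g16)): `isVertex_smul_form_iff`; brings ★ `isVertex_formCongr_iff`, `isSelfDualLattice_formCongr_iff`, `isVertexLattice_smul_iff`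
import Literature.NumberTheory.Automorphic.UnitaryLatticeTreeStarOfInvolution    -- ★ (F0P2-p06): `isSelfDualLattice_iff_not_isSelfDualLattice_of_adj_of_v` (alternation in the antidiagonal model, datum-free)
import HarnessLib

/-!
# The lattice graph of a hermitian space — TYPES ALTERNATE ALONG EDGES IN EVERY MODEL `c·ᵗσ(P) H P` of a form `H` in which they alternate; in particular in every
# model `c·ᵗσ(P) J₀ P` of the antidiagonal form at `N = 3` (Bruhat–Tits 1972 §10; Serre, *Trees* II.1.1)

Topic `NumberTheory/Automorphic`; namespace `Literature.NumberTheory.Automorphic.UnitaryLatticeTree`.  THEOREMS ONLY (no definition, no instance, no notation, no named fact,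
no `sorry`); kernel lane `--supports stmt-HodgeConjecture-24833`; datum-free (`K` with `Valued K ℤᵐ⁰`; §2 uses `σ` valuation-preserving and `|ϖ| = exp(−1)`, any `σ`-behaviour
of `ϖ`).  Cell `pub/hodgecm-mathlib` (D-0151), crux H413; road «S3-ram» (Literature seeding, count-neutral).  Item **J2 «ALTERNATION IN ANY MODEL»** of F0P3a-p01 (g16)'s junction
plan «J-PACK» (between the ★ tree-induction engine p847302 `DepthZeroKappaTransferTypeOneRamifiedTreeInduction` and the statement-first head of the ramified type-(1) G-side law):
the engine's hypotheses `hSD₁ : Adj v c → SD v → ¬ SD c` and `hSD₂ : Adj c w → ¬ SD c → SD w` with `SD = IsSelfDualLattice σ ϖ H` must hold in the LITERAL'S model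
`H = c • formCongr σ P J₀` (`|c| = 1`, `P ∈ GL₃(K)`: every unimodular hermitian form is such a model — ★ `exists_glInt_eq_smul_formCongr_antidiagonal_of_…`, and the literal's
diagonal eigenframe form `diag(d_b)` in particular), while the tree's alternation theorem ★ `isSelfDualLattice_iff_not_isSelfDualLattice_of_adj_of_v` is stated in the antidiagonal
model `J₀`.  THIS FILE transports it: §1 for ANY form `H` and any model `c • formCongr σ P H` of it (adjacency = strict inclusion is preserved by `M ↦ P·M`, ★ `mapGL_lt_mapGL_iff`;
self-duality corresponds by ★ `isSelfDualLattice_formCongr_iff` ∘ ★ `isVertexLattice_smul_iff`), §2 the antidiagonal instance at `N = 3` and the two one-directional shapes the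
engine consumes.
HONEST LABEL: HC_CM is proved only modulo the 2 remaining named inputs (hLiu418 24832, h413 24833) until rung 0 closes; nothing printed is asserted here (bookkeeping).

* §1 `isVertex_of_isVertex_smul_formCongr` (vertices of the model are `P`-translates of vertices), `latticeGraph_adj_mapGL_of_adj_smul_formCongr` (edges go to edges),
  `isSelfDualLattice_smul_formCongr_iff` (self-duality corresponds), **`isSelfDualLattice_iff_not_of_adj_smul_formCongr`** (alternation transports to the model).
* §2 **`isSelfDualLattice_iff_not_isSelfDualLattice_of_adj_smul_formCongr_antidiagonal`** (`N = 3`, any model of `J₀`), `not_isSelfDualLattice_of_adj_smul_formCongr_antidiagonal`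
  (`hSD₁`), `isSelfDualLattice_of_adj_of_not_smul_formCongr_antidiagonal` (`hSD₂`).

## References
* [BruhatTits1972] F. Bruhat, J. Tits, *Groupes réductifs sur un corps local I*, Publ. Math. IHÉS 41 (1972), §10 (vertex types of the lattice model; change of frame).
* [Serre1980Trees] J.-P. Serre, *Trees* (1980), Ch. II §1.1 (the bipartition of the tree of lattices).
-/

set_option autoImplicit false

noncomputable section

open scoped Valued WithZero Matrix MatrixGroups

namespace Literature.NumberTheory.Automorphic.UnitaryLatticeTree

open Literature.NumberTheory.Automorphic Literature.NumberTheory.Automorphic.HermitianLattice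

variable {K : Type*} [Field K] [Valued K ℤᵐ⁰] {N : ℕ} {σ : K →+* K} {ϖ : K}

/-! ## §1 Any form `H`: alternation transports to every model `c • ᵗσ(P) H P` -/

/-- A vertex `M` of the model `c • formCongr σ P H` (`|c| = 1`) gives the vertex `P·M` of `H`. [cite: BruhatTits1972, §10] -/
theorem isVertex_of_isVertex_smul_formCongr {c : K} (hc : Valued.v c = 1) (H : Matrix (Fin N) (Fin N) K) (P : GL (Fin N) K)
    {M : Submodule 𝒪[K] (Fin N → K)} (hM : IsVertex σ ϖ (c • formCongr σ P H) M) : IsVertex σ ϖ H (mapGL P M) :=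
  (isVertex_formCongr_iff (σ := σ) (ϖ := ϖ) P H M).1 ((isVertex_smul_form_iff σ ϖ hc (formCongr σ P H) M).1 hM)

/-- Self-duality corresponds under the change of model: `M` is self-dual for `c • formCongr σ P H` (`|c| = 1`) iff `P·M` is self-dual for `H`. [cite: BruhatTits1972, §10] -/
theorem isSelfDualLattice_smul_formCongr_iff {c : K} (hc : Valued.v c = 1) (H : Matrix (Fin N) (Fin N) K) (P : GL (Fin N) K) (M : Submodule 𝒪[K] (Fin N → K)) :
    IsSelfDualLattice σ ϖ (c • formCongr σ P H) M ↔ IsSelfDualLattice σ ϖ H (mapGL P M) := by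
  rw [IsSelfDualLattice, isVertexLattice_smul_iff (σ := σ) (ϖ := ϖ) hc (formCongr σ P H) 0 M]
  exact isSelfDualLattice_formCongr_iff (σ := σ) (ϖ := ϖ) P H M

/-- Edges go to edges: if `v, w` are adjacent in the lattice graph of `c • formCongr σ P H` (`|c| = 1`) then `P·v, P·w` are adjacent in the lattice graph of `H` (adjacency is
strict inclusion, preserved by `M ↦ P·M`). [cite: Serre1980Trees, II.1.1] [cite: BruhatTits1972, §10] -/
theorem latticeGraph_adj_mapGL_of_adj_smul_formCongr {c : K} (hc : Valued.v c = 1) (H : Matrix (Fin N) (Fin N) K) (P : GL (Fin N) K)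
    {v w : {M : Submodule 𝒪[K] (Fin N → K) // IsVertex σ ϖ (c • formCongr σ P H) M}} (h : (latticeGraph σ ϖ (c • formCongr σ P H)).Adj v w) :
    (latticeGraph σ ϖ H).Adj ⟨mapGL P v.1, isVertex_of_isVertex_smul_formCongr hc H P v.2⟩ ⟨mapGL P w.1, isVertex_of_isVertex_smul_formCongr hc H P w.2⟩ := by
  rw [latticeGraph_adj_iff] at h ⊢
  simpa only [mapGL_lt_mapGL_iff] using h

/-- **ALTERNATION TRANSPORTS TO EVERY MODEL.**  If along every edge of the lattice graph of `H` exactly one end is self-dual, the same holds in the lattice graph of every model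
`c • formCongr σ P H` (`|c| = 1`, `P ∈ GL_N(K)`). [cite: BruhatTits1972, §10] [cite: Serre1980Trees, II.1.1] -/
theorem isSelfDualLattice_iff_not_of_adj_smul_formCongr {c : K} (hc : Valued.v c = 1) (H : Matrix (Fin N) (Fin N) K) (P : GL (Fin N) K)
    (halt : ∀ v w : {M : Submodule 𝒪[K] (Fin N → K) // IsVertex σ ϖ H M},
      (latticeGraph σ ϖ H).Adj v w → (IsSelfDualLattice σ ϖ H v.1 ↔ ¬ IsSelfDualLattice σ ϖ H w.1))
    {v w : {M : Submodule 𝒪[K] (Fin N → K) // IsVertex σ ϖ (c • formCongr σ P H) M}} (h : (latticeGraph σ ϖ (c • formCongr σ P H)).Adj v w) :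
    IsSelfDualLattice σ ϖ (c • formCongr σ P H) v.1 ↔ ¬ IsSelfDualLattice σ ϖ (c • formCongr σ P H) w.1 := by
  rw [isSelfDualLattice_smul_formCongr_iff hc H P v.1, isSelfDualLattice_smul_formCongr_iff hc H P w.1]
  exact halt _ _ (latticeGraph_adj_mapGL_of_adj_smul_formCongr hc H P h)

/-! ## §2 The antidiagonal form at `N = 3`: alternation in every model `c • ᵗσ(P) J₀ P` -/

/-- **TYPES ALTERNATE ALONG EDGES IN EVERY MODEL OF `J₀` (`N = 3`)**: for `σ` valuation-preserving, `|ϖ| = exp(−1)`, `|c| = 1`, `P ∈ GL₃(K)` and adjacent vertices `v, w` of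
the lattice graph of `c • formCongr σ P J₀`: `v` is self-dual iff `w` is not (★ `isSelfDualLattice_iff_not_isSelfDualLattice_of_adj_of_v` transported by §1).
[cite: BruhatTits1972, §10] [cite: Serre1980Trees, II.1.1] -/
theorem isSelfDualLattice_iff_not_isSelfDualLattice_of_adj_smul_formCongr_antidiagonal (hvσ : ∀ a, Valued.v (σ a) = Valued.v a)
    (hϖ : Valued.v ϖ = WithZero.exp (-1 : ℤ)) {c : K} (hc : Valued.v c = 1) (P : GL (Fin 3) K)
    {v w : {M : Submodule 𝒪[K] (Fin 3 → K) // IsVertex σ ϖ (c • formCongr σ P ((StdForm.antidiagonal 3).over K)) M}}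
    (h : (latticeGraph σ ϖ (c • formCongr σ P ((StdForm.antidiagonal 3).over K))).Adj v w) :
    IsSelfDualLattice σ ϖ (c • formCongr σ P ((StdForm.antidiagonal 3).over K)) v.1 ↔
      ¬ IsSelfDualLattice σ ϖ (c • formCongr σ P ((StdForm.antidiagonal 3).over K)) w.1 :=
  isSelfDualLattice_iff_not_of_adj_smul_formCongr hc _ P (fun _ _ hvw => isSelfDualLattice_iff_not_isSelfDualLattice_of_adj_of_v hvσ hϖ hvw) h

/-- The engine's `hSD₁` in the model `c • formCongr σ P J₀`: a neighbour of a self-dual vertex is not self-dual. [cite: BruhatTits1972, §10] [cite: Serre1980Trees, II.1.1] -/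
theorem not_isSelfDualLattice_of_adj_smul_formCongr_antidiagonal (hvσ : ∀ a, Valued.v (σ a) = Valued.v a)
    (hϖ : Valued.v ϖ = WithZero.exp (-1 : ℤ)) {c : K} (hc : Valued.v c = 1) (P : GL (Fin 3) K)
    (v w : {M : Submodule 𝒪[K] (Fin 3 → K) // IsVertex σ ϖ (c • formCongr σ P ((StdForm.antidiagonal 3).over K)) M})
    (h : (latticeGraph σ ϖ (c • formCongr σ P ((StdForm.antidiagonal 3).over K))).Adj v w)
    (hv : IsSelfDualLattice σ ϖ (c • formCongr σ P ((StdForm.antidiagonal 3).over K)) v.1) :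
    ¬ IsSelfDualLattice σ ϖ (c • formCongr σ P ((StdForm.antidiagonal 3).over K)) w.1 :=
  (isSelfDualLattice_iff_not_isSelfDualLattice_of_adj_smul_formCongr_antidiagonal hvσ hϖ hc P h).1 hv

/-- The engine's `hSD₂` in the model `c • formCongr σ P J₀`: a neighbour of a non-self-dual vertex is self-dual. [cite: BruhatTits1972, §10] [cite: Serre1980Trees, II.1.1] -/
theorem isSelfDualLattice_of_adj_of_not_smul_formCongr_antidiagonal (hvσ : ∀ a, Valued.v (σ a) = Valued.v a)
    (hϖ : Valued.v ϖ = WithZero.exp (-1 : ℤ)) {c : K} (hc : Valued.v c = 1) (P : GL (Fin 3) K)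
    (v w : {M : Submodule 𝒪[K] (Fin 3 → K) // IsVertex σ ϖ (c • formCongr σ P ((StdForm.antidiagonal 3).over K)) M})
    (h : (latticeGraph σ ϖ (c • formCongr σ P ((StdForm.antidiagonal 3).over K))).Adj v w)
    (hv : ¬ IsSelfDualLattice σ ϖ (c • formCongr σ P ((StdForm.antidiagonal 3).over K)) v.1) :
    IsSelfDualLattice σ ϖ (c • formCongr σ P ((StdForm.antidiagonal 3).over K)) w.1 := by
  by_contra hw
  exact hv ((isSelfDualLattice_iff_not_isSelfDualLattice_of_adj_smul_formCongr_antidiagonal hvσ hϖ hc P h).2 hw)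

end Literature.NumberTheory.Automorphic.UnitaryLatticeTree

end
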